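import Summits.QuantumFields.BalabanUV.T4Continuum.Support.NE7EJBracketPath

/-!
# NE7EJBracketSecondOrder — row NE7 (node U5), candidate route HOM, variant H1L-EJ: THE INFINITESIMAL (E4) — ALONG THE τ-LINE OF QUADRATIC
# ACTIONS THE DEFECT AT THE MINIMISER IS DIFFERENTIABLE WITH DERIVATIVE `−2·q(τ,τ)`, i.e. `g″(τ) = −2⟨E U_τB, G_τ E U_τB⟩ ≤ 0`

Lineage `b2b-balaban-t4-ne7-p2` (CRUX PROVER NE7 #2 = C-HOM°'s kernel hand), generation 80; file 115 (sequel of 109 `NE7EJBracketPath`, which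
left «the infinitesimal second-order form g″(τ) = −q(τ) (which needs continuity of σ ↦ G_σ)» untyped).  CONSUMER SHAPE (by name): lens 2's S-91-1
(`t4/ideate/NE7/lens2-g91/ENVELOPE-SUPPLY.md` §2 (E4)): «g″(τ) = ⟨d𝔇(U_τ), ∂_τU_τ⟩ = −q(τ), q(τ) := ⟨P d𝔇(U_τ), H_τ^{−1} P d𝔇(U_τ)⟩ … so (E3)'s
concavity is recovered with its curvature named».  In file 109's normalisation (`g(τ) = ⟨B, P_τ⁻¹B⟩`, twice lens 2's `½`-convention, so the
curvature is `−2q`):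
* §1 CONTINUITY ALONG THE LINE (Mathlib's `continuousAt_matrix_inv` at a positive point + `NormedRing.inverse_continuousAt`): `continuous_lineK`,
  `continuousAt_inv_of_posDef`, `continuousAt_matMul`, `continuousAt_blockProp_lineK`, `continuousAt_blockPropInv_lineK`, `continuousAt_minMap_lineK`,
  `continuousAt_constrProp_lineK`, `continuousAt_lineMin`.
* §2 THE EXACT INCREMENT OF THE DEFECT FORM: `qf_sub_qf_of_symm` (`⟨a,Ea⟩ − ⟨b,Eb⟩ = ⟨a−b, E(a+b)⟩`), `lineMin_sub` (`U_σB − U_τB =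
  −(σ−τ)·G_σ E U_τB`, the exact minimiser response), **`defectForm_sub`** (`f(σ) − f(τ) = −(σ−τ)·⟨G_σ E U_τB, E(U_σB + U_τB)⟩`).
* §3 **`hasDerivWithinAt_defectForm`**: `f(τ) := ⟨U_τB, E U_τB⟩` (= `g′(τ)` by 109's Hellmann–Feynman) has derivative `−2·q(τ,τ)` within `[0,1]`
  at every `τ ∈ [0,1]` — **(E4) INFINITESIMAL: `g″ = −2q ≤ 0`**; `deriv_defectForm_nonpos`.

HONEST FRAMING: [folklore] (continuity of the matrix inverse at an invertible point; exact resolvent increments); REAL forms on `[0,1]`; nothing of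
Bałaban's instantiated; NOT the complex-domain bound (K1-var(s) quantitative), NOT (N1-δ), NOT EJ-1c ∕ EJ-2 ∕ EJ-3; NOT a letter move; credit (E4)
lens 2 g91.  NE7 NOT PRINTED ∕ NOT PROVED; spine 0∕9; FIXED FINITE T⁴, rung (B)+1; NOT infinite volume, NOT mass gap, NOT Clay.  HONEST DEPENDENCY:
continuum YM on T⁴ ⇐ BetaPertH ∧ nine spine estimates (0/9 proved); BetaPertH ⇐ (D1) ∧ (D4) ∧ CAP+tail; G-an2-4 gates asym, D1 and NE2/3/4.
-/

noncomputable section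

open Matrix Set Filter Topology

namespace Summit.QuantumFields.BalabanUV.T4Continuum.NE7EJBracketSecondOrder

open Literature.MathematicalPhysics.QuantumFieldTheory.Balaban1983to89.Beta.Composition (blockProp)
open Literature.MathematicalPhysics.QuantumFieldTheory.Balaban1983to89.Beta.Envelope
open NE7EJBracket NE7EJBracketForms NE7EJBracketPath

variable {ν μ : Type*} [Fintype ν] [Fintype μ] [DecidableEq ν] [DecidableEq μ]

/-! ### §1 Continuity of the line's objects at a positive point -/

section Continuity

variable {K₀ E : Matrix ν ν ℝ} {Q : Matrix μ ν ℝ}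

omit [Fintype ν] [Fintype μ] [DecidableEq ν] [DecidableEq μ] in
/-- the line of forms is continuous in the parameter. [folklore] -/
theorem continuous_lineK (K₀ E : Matrix ν ν ℝ) : Continuous fun σ : ℝ => lineK K₀ E σ := by
  simp only [lineK_apply]
  exact continuous_const.add (continuous_id.smul continuous_const)

omit [Fintype μ] [DecidableEq μ] in
/-- the matrix inverse is continuous at a positive definite value of a continuous matrix function. [folklore] -/
theorem continuousAt_inv_of_posDef {A : ℝ → Matrix ν ν ℝ} {τ : ℝ} (hA : ContinuousAt A τ) (hτ : (A τ).PosDef) :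
    ContinuousAt (fun σ => (A σ)⁻¹) τ := by
  have hdet : IsUnit (A τ).det := isUnit_det_of_posDef hτ
  have hinv : ContinuousAt Ring.inverse (A τ).det := by
    obtain ⟨u, hu⟩ := hdet
    rw [← hu]
    exact NormedRing.inverse_continuousAt u
  exact (continuousAt_matrix_inv (A τ) hinv).comp hA

omit [DecidableEq ν] [DecidableEq μ] in
/-- products of matrix functions continuous at a point are continuous at the point (any compatible shapes). [folklore] -/
theorem continuousAt_matMul {l m p : Type*} [Fintype l] [Fintype m] [Fintype p] {f : ℝ → Matrix l m ℝ} {g : ℝ → Matrix m p ℝ} {τ : ℝ}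
    (hf : ContinuousAt f τ) (hg : ContinuousAt g τ) : ContinuousAt (fun σ => f σ * g σ) τ :=
  ((continuous_fst.matrix_mul continuous_snd).continuousAt).comp (hf.prodMk hg)

/-- `σ ↦ (K_σ)⁻¹` is continuous at every `τ ∈ [0,1]`. [folklore] -/
theorem continuousAt_inv_lineK (h0 : K₀.PosDef) (h1 : (K₀ + E).PosDef) {τ : ℝ} (hτ : τ ∈ Icc (0:ℝ) 1) :
    ContinuousAt (fun σ => (lineK K₀ E σ)⁻¹) τ :=
  continuousAt_inv_of_posDef (continuous_lineK K₀ E).continuousAt (lineK_posDef h0 h1 hτ)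

omit [DecidableEq μ] in
/-- `σ ↦ P_σ = Q K_σ⁻¹ Qᵀ` is continuous at every `τ ∈ [0,1]`. [folklore] -/
theorem continuousAt_blockProp_lineK (h0 : K₀.PosDef) (h1 : (K₀ + E).PosDef) {τ : ℝ} (hτ : τ ∈ Icc (0:ℝ) 1) :
    ContinuousAt (fun σ => blockProp (lineK K₀ E σ) Q) τ := by
  simp only [blockProp_eq]
  exact continuousAt_matMul (continuousAt_matMul continuousAt_const (continuousAt_inv_lineK h0 h1 hτ)) continuousAt_const

/-- `σ ↦ P_σ⁻¹` is continuous at every `τ ∈ [0,1]`. [folklore] -/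
theorem continuousAt_blockPropInv_lineK (h0 : K₀.PosDef) (h1 : (K₀ + E).PosDef) (hQ : Function.Injective Q.vecMul) {τ : ℝ}
    (hτ : τ ∈ Icc (0:ℝ) 1) : ContinuousAt (fun σ => (blockProp (lineK K₀ E σ) Q)⁻¹) τ :=
  continuousAt_inv_of_posDef (continuousAt_blockProp_lineK h0 h1 hτ) (blockProp_posDef (lineK_posDef h0 h1 hτ) hQ)

/-- `σ ↦ H_σ = minMap K_σ Q` is continuous at every `τ ∈ [0,1]`. [folklore] -/
theorem continuousAt_minMap_lineK (h0 : K₀.PosDef) (h1 : (K₀ + E).PosDef) (hQ : Function.Injective Q.vecMul) {τ : ℝ}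
    (hτ : τ ∈ Icc (0:ℝ) 1) : ContinuousAt (fun σ => minMap (lineK K₀ E σ) Q) τ := by
  simp only [minMap]
  exact continuousAt_matMul (continuousAt_matMul (continuousAt_inv_lineK h0 h1 hτ) continuousAt_const)
    (continuousAt_blockPropInv_lineK h0 h1 hQ hτ)

/-- `σ ↦ G_σ = constrProp K_σ Q` is continuous at every `τ ∈ [0,1]`. [folklore] -/
theorem continuousAt_constrProp_lineK (h0 : K₀.PosDef) (h1 : (K₀ + E).PosDef) (hQ : Function.Injective Q.vecMul) {τ : ℝ}
    (hτ : τ ∈ Icc (0:ℝ) 1) : ContinuousAt (fun σ => constrProp (lineK K₀ E σ) Q) τ := by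
  simp only [constrProp]
  exact (continuousAt_inv_lineK h0 h1 hτ).sub
    (continuousAt_matMul (continuousAt_matMul (continuousAt_minMap_lineK h0 h1 hQ hτ) continuousAt_const) (continuousAt_inv_lineK h0 h1 hτ))

omit [DecidableEq ν] [DecidableEq μ] in
/-- a matrix function continuous at a point, applied to a fixed vector, is continuous at the point. [folklore] -/
theorem continuousAt_mulVec_const {l m : Type*} [Fintype l] [Fintype m] {f : ℝ → Matrix l m ℝ} {τ : ℝ} (hf : ContinuousAt f τ) (v : m → ℝ) :
    ContinuousAt (fun σ => f σ *ᵥ v) τ :=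
  ((continuous_id.matrix_mulVec continuous_const).continuousAt).comp hf

/-- `σ ↦ U_σB = H_σ B` is continuous at every `τ ∈ [0,1]`. [folklore] -/
theorem continuousAt_lineMin (h0 : K₀.PosDef) (h1 : (K₀ + E).PosDef) (hQ : Function.Injective Q.vecMul) (B : μ → ℝ) {τ : ℝ}
    (hτ : τ ∈ Icc (0:ℝ) 1) : ContinuousAt (fun σ => lineMin K₀ E Q B σ) τ := by
  simp only [lineMin_apply]
  exact continuousAt_mulVec_const (continuousAt_minMap_lineK h0 h1 hQ hτ) B

end Continuity

/-! ### §2 The exact increment of the defect form along the line -/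

section Increment

variable {K₀ E : Matrix ν ν ℝ} {Q : Matrix μ ν ℝ}

omit [Fintype μ] [DecidableEq ν] [DecidableEq μ] in
/-- for a symmetric form, `⟨a, Ea⟩ − ⟨b, Eb⟩ = ⟨a − b, E(a + b)⟩`. [folklore] -/
theorem qf_sub_qf_of_symm (hEs : Eᵀ = E) (a b : ν → ℝ) : qf E a - qf E b = (a - b) ⬝ᵥ (E *ᵥ (a + b)) := by
  have hc : a ⬝ᵥ (E *ᵥ b) = b ⬝ᵥ (E *ᵥ a) := dotProduct_mulVec_comm E hEs a b
  rw [qf_apply, qf_apply, mulVec_add, dotProduct_add, sub_dotProduct, sub_dotProduct, hc]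
  ring

omit [Fintype ν] [Fintype μ] [DecidableEq ν] [DecidableEq μ] in
/-- the defect form of two positive forms is symmetric. [folklore] -/
theorem transpose_E_of_posDef (h0 : K₀.PosDef) (h1 : (K₀ + E).PosDef) : Eᵀ = E := by
  have e : E = (K₀ + E) - K₀ := (add_sub_cancel_left K₀ E).symm
  rw [e, transpose_sub, transpose_eq_of_posDef h0, transpose_eq_of_posDef h1]

/-- THE EXACT MINIMISER RESPONSE along the line: `U_σB − U_τB = −(σ−τ)·G_σ E U_τB`. [folklore] -/
theorem lineMin_sub (h0 : K₀.PosDef) (h1 : (K₀ + E).PosDef) (hQ : Function.Injective Q.vecMul) (B : μ → ℝ) {τ σ : ℝ}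
    (hτ : τ ∈ Icc (0:ℝ) 1) (hσ : σ ∈ Icc (0:ℝ) 1) :
    lineMin K₀ E Q B σ - lineMin K₀ E Q B τ = -((σ - τ) • (constrProp (lineK K₀ E σ) Q *ᵥ (E *ᵥ lineMin K₀ E Q B τ))) := by
  have h := minMap_sub_minMap_mulVec (lineK_posDef h0 h1 hτ) (lineK_posDef h0 h1 hσ) hQ B
  rw [lineK_sub, Matrix.mul_smul, Matrix.smul_mul, smul_mulVec, ← mulVec_mulVec, ← mulVec_mulVec] at h
  rw [lineMin_apply, lineMin_apply, ← neg_sub, h]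

/-- **THE EXACT INCREMENT OF THE DEFECT FORM**: `f(σ) − f(τ) = −(σ−τ)·⟨G_σ E U_τB, E (U_σB + U_τB)⟩`. [folklore] -/
theorem defectForm_sub (h0 : K₀.PosDef) (h1 : (K₀ + E).PosDef) (hQ : Function.Injective Q.vecMul) (B : μ → ℝ) {τ σ : ℝ}
    (hτ : τ ∈ Icc (0:ℝ) 1) (hσ : σ ∈ Icc (0:ℝ) 1) :
    qf E (lineMin K₀ E Q B σ) - qf E (lineMin K₀ E Q B τ) =
      -((σ - τ) * ((constrProp (lineK K₀ E σ) Q *ᵥ (E *ᵥ lineMin K₀ E Q B τ)) ⬝ᵥ (E *ᵥ (lineMin K₀ E Q B σ + lineMin K₀ E Q B τ)))) := by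
  rw [qf_sub_qf_of_symm (transpose_E_of_posDef h0 h1), lineMin_sub h0 h1 hQ B hτ hσ, neg_dotProduct, smul_dotProduct, smul_eq_mul]

end Increment

/-! ### §3 (E4) infinitesimal: `g″(τ) = −2·q(τ,τ) ≤ 0` -/

section SecondOrder

variable {K₀ E : Matrix ν ν ℝ} {Q : Matrix μ ν ℝ}

omit [DecidableEq ν] [DecidableEq μ] in
/-- the dot product of two vector functions continuous at a point is continuous at the point. [folklore] -/
theorem continuousAt_dotProduct' {m : Type*} [Fintype m] {f g : ℝ → m → ℝ} {τ : ℝ} (hf : ContinuousAt f τ) (hg : ContinuousAt g τ) :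
    ContinuousAt (fun σ => f σ ⬝ᵥ g σ) τ :=
  ((continuous_fst.dotProduct continuous_snd).continuousAt).comp (hf.prodMk hg)

/-- **(E4) INFINITESIMAL**: the defect at the line's minimiser, `f(τ) = ⟨U_τB, E U_τB⟩` (the derivative of the value `g` by file 109's
Hellmann–Feynman), is differentiable within `[0,1]` at every `τ ∈ [0,1]` with derivative `−2·q(τ,τ) = −2⟨E U_τB, G_τ (E U_τB)⟩` — lens 2's
«g″(τ) = −q(τ)» in file 109's normalisation. [folklore] -/
theorem hasDerivWithinAt_defectForm (h0 : K₀.PosDef) (h1 : (K₀ + E).PosDef) (hQ : Function.Injective Q.vecMul) (B : μ → ℝ) {τ : ℝ}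
    (hτ : τ ∈ Icc (0:ℝ) 1) :
    HasDerivWithinAt (fun σ => qf E (lineMin K₀ E Q B σ)) (-(2 * qrem K₀ E Q B τ τ)) (Icc (0:ℝ) 1) τ := by
  -- the slope from τ to σ is φ(σ) := −⟨G_σ E U_τB, E(U_σB + U_τB)⟩, continuous at τ with value −2q(τ,τ) there
  set x : ν → ℝ := E *ᵥ lineMin K₀ E Q B τ with hx
  set φ : ℝ → ℝ := fun σ =>
    -((constrProp (lineK K₀ E σ) Q *ᵥ x) ⬝ᵥ (E *ᵥ (lineMin K₀ E Q B σ + lineMin K₀ E Q B τ))) with hφ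
  have hcont : ContinuousAt φ τ := by
    refine ContinuousAt.neg (continuousAt_dotProduct' ?_ ?_)
    · exact continuousAt_mulVec_const (continuousAt_constrProp_lineK h0 h1 hQ hτ) x
    · have hv : ContinuousAt (fun σ => lineMin K₀ E Q B σ + lineMin K₀ E Q B τ) τ :=
        (continuousAt_lineMin h0 h1 hQ B hτ).add continuousAt_const
      exact ((continuous_const.matrix_mulVec continuous_id).continuousAt).comp hv
  have hval : φ τ = -(2 * qrem K₀ E Q B τ τ) := by
    have h2 : lineMin K₀ E Q B τ + lineMin K₀ E Q B τ = (2:ℝ) • lineMin K₀ E Q B τ := by rw [two_smul]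
    simp only [hφ, qrem_apply]
    rw [h2, mulVec_smul, ← hx, dotProduct_smul, smul_eq_mul, dotProduct_comm]
  have hlim : Tendsto φ (𝓝[Icc (0:ℝ) 1 \ {τ}] τ) (𝓝 (-(2 * qrem K₀ E Q B τ τ))) := by
    rw [← hval]
    exact hcont.tendsto.mono_left nhdsWithin_le_nhds
  have heq : ∀ᶠ σ in 𝓝[Icc (0:ℝ) 1 \ {τ}] τ, φ σ = slope (fun σ => qf E (lineMin K₀ E Q B σ)) τ σ := by
    refine eventually_nhdsWithin_of_forall fun σ hσ => ?_
    have hσI : σ ∈ Icc (0:ℝ) 1 := hσ.1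
    have hne : σ - τ ≠ 0 := sub_ne_zero.mpr (fun h => hσ.2 h)
    rw [slope_def_field, defectForm_sub h0 h1 hQ B hτ hσI, ← hx]
    simp only [hφ]
    field_simp
  rw [hasDerivWithinAt_iff_tendsto_slope]
  exact hlim.congr' heq

/-- hence **`g″ ≤ 0`**: the derivative of the defect form along the line is non-positive ((E3)'s concavity with its curvature named). [folklore] -/
theorem deriv_defectForm_nonpos (h0 : K₀.PosDef) (h1 : (K₀ + E).PosDef) (hQ : Function.Injective Q.vecMul) (B : μ → ℝ) {τ : ℝ}
    (hτ : τ ∈ Icc (0:ℝ) 1) : -(2 * qrem K₀ E Q B τ τ) ≤ 0 := by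
  have h := qrem_nonneg h0 h1 hQ B τ hτ
  linarith

end SecondOrder

end Summit.QuantumFields.BalabanUV.T4Continuum.NE7EJBracketSecondOrder

end
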